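import Literature.IUT.HodgeTheaters.GoodLocalFrobenioidOfKitQpTwist
import HarnessLib

/-!
# [IUTchI] Example 3.3 (iii) (e) FAILS at the real instance `GoodLocalFrobenioid.ofKitQp p`:
# the [FrdII] Remark 1.2.2 unit twist `p ↦ -p` of `C(ℚ_p)` admits no `τ⊢`-preserving lift to `C⊢(ℚ_p)`

Mochizuki, *Inter-universal Teichmüller theory I*, §3, Example 3.3 (iii) (e), kurims May-2020 manuscript p. 79
[claim: Mochizuki2012, status: disputed]: "(e) … one may reconstruct the split Frobenioids `F⊢_v`, `F^Θ_v`
category-theoretically from `F̲_v` [cf. [AbsTopIII], Proposition 3.2, (iii) …]"; Mochizuki, *The geometry of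
Frobenioids II*, Kyushu J. Math. **62** (2008), §1, Remark 1.2.2 p. 10 [cite: MochizukiFrdII2008, Rmk 1.2.2 p.10]
("a situation which, of course, never arises in conventional scheme theory"). abc-iut cell, WAVE-4 seat abc-iut-w4-d047
(gen 2); DAG node `IUTchI:Ex3.3(iii)`; row E33iii/e of `plan/L5/SUBDAG-IUTchI-Ex33-Ex34.md`.

abc-iut-L5-t2 typed clause (e) as the model-relative `Prop` `GoodLocalFrobenioid.SplitFromF G` (`SplitFrobenioids.lean`):
EVERY self-equivalence `e` of `F̲_v = C_v` lifts along `C⊢_v ⊆ C_v` to a self-equivalence `e'` of `C⊢_v` PRESERVING the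
characteristic splitting `τ⊢_v` (and, through `F⊢_v ⥲ F^Θ_v`, to one of `C^Θ_v` preserving `τ^Θ_v`). THIS FILE proves
`¬ (GoodLocalFrobenioid.ofKitQp p).SplitFromF` for every prime `p` — at abc-iut-L5-t2's REAL instance over the one-object
base (`GoodLocalFrobenioidOfKit.lean`: `C_v = C(ℚ_p)`, `C⊢_v = C⊢(ℚ_p)` are abc-iut-L1-t4's [FrdII] Ex. 1.1 (ii)
model Frobenioids, `τ⊢_v = τ_p` is [FrdII] Thm. 1.2 (v)'s splitting `Datum.primSplitting`).

PROOF. Take `e := Ψ_U` (`GoodLocalFrobenioidOfKitQpTwist.lean`: the self-equivalence of `C(ℚ_p)` induced by the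
automorphism `U = (id_Φ, β)`, `β(b) = b · w^{v_p(b)}`, `w` the lift of `-1` — [FrdII] Rmk. 1.2.2's `U` for `u_D ≡ -1`).
`Ψ_U` multiplies rational functions by `(-1)^{v_p}`: the generator `t = (1, id, log p, p)` of `τ_p(X)` (`genEnd`), seen in
`C_v`, goes to an endomorphism with rational function `-p`. If `e'` lifts `Ψ_U` (`(C⊢ ⊆ C) ⋙ Ψ_U ≅ e' ⋙ (C⊢ ⊆ C)`), then
`(C⊢ ⊆ C)(e' t)` is CONJUGATE by the comparison isomorphism to `Ψ_U((C⊢ ⊆ C) t)`; over the one-object base conjugation by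
an isomorphism does not change rational functions (`rfQ_unit_conj`: `K^×` commutative, all pull-backs trivial), so `e' t`
has rational function `-p`. But `e'` preserves `τ_p`, whose elements have rational functions `p^m`, `m ∈ ℕ`; `p^m = -p` forces
`m = 1` (valuations) and then `2p = 0` in `ℚ_p` — absurd.

READING (for dag / L5-lead / FACT-LIST): like the other Ex. 3.2/3.3 reconstruction clauses, (e) is a SCHEMA — it holds
on the trivial inhabitant (`GoodLocalFrobenioidClaimsWitness.lean`) and FAILS here, at the first REAL instance; so the
typed `SplitFromF` is admissible per NAMED instance only, never ∀-closed (`not_forall_splitFromF`). Mathematically the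
failure isolates what print's (e) uses beyond [FrdI]/[FrdII] category-theoreticity: the ELEMENT `p_v ∈ K_v` must be
recovered through the Kummer map of [AbsTopIII] Prop. 3.2 (iii) from `X_F` of strictly Belyi type (Rmk. 3.3.2), which
the degenerate base `Spec ℚ_p` (trivial `Π`) cannot supply — [FrdII] Rmk. 1.2.2's phenomenon, kernel-checked. By
contrast (b)(c) HOLD at the real instances (`GoodLocalFrobenioidOfKitBases.lean`, from [FrdI] Thm. 3.4 (v)) and
(a)(b)(c) at `ofKitQp` (`GoodLocalFrobenioidOfKitQpReconstruction.lean`).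

Definitions introduced (bookkeeping, review lane): `rfQ`/`rfQ'` (rational-function maps `B(A) → ℚ_pˣ`, `B⊢(A) → ℚ_pˣ`),
`pU` (`p ∈ ℚ_pˣ`), `ptObj` (an object of `C⊢(ℚ_p)`), `genEnd` (the generator `(1, id, log p, p)` of `τ_p(ptObj)`).
Nothing of the disputed series is asserted; typed ≠ proved; no side is taken on [IUTchIII] Cor. 3.12.
-/


noncomputable section

namespace Literature.IUT.HodgeTheaters

namespace GoodLocalFrobenioid

open CategoryTheory Opposite Literature.AlgebraicGeometry.Frobenioids Literature.AlgebraicGeometry.Frobenioids.PadicFrd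

variable (p : ℕ) [Fact p.Prime]

/-! ### Rational functions (valued in `ℚ_pˣ`) along `C⊢_v ⊆ C_v`, under conjugation; the generator of `τ⊢_v` -/

section Transport

/-- The rational-function map `B(A) → K_A^× = ℚ_pˣ` of `C_v = C(ℚ_p)` ([FrdII] Ex. 1.1 (ii): `u ↦ u|_{K^×}`),
with values read in `ℚ_pˣ`. [cite: MochizukiFrdII2008, Ex 1.1 (ii) p.8] -/
def rfQ (A : Discrete PUnit.{1}) : (qpPerfDatum p).B.obj (op A) →* ℚ_[p]ˣ := (qpPerfDatum p).resK A

/-- The rational-function map `B⊢(A) → ℚ_pˣ` of `C⊢_v = C⊢(ℚ_p)`. [cite: MochizukiFrdII2008, Ex 1.1 (ii) p.8] -/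
def rfQ' (A : Discrete PUnit.{1}) : (qpPrimDatum p).B.obj (op A) →* ℚ_[p]ˣ := (qpPrimDatum p).resK A

/-- `rfQ` is `resK`. [cite: MochizukiFrdII2008, Ex 1.1 (ii) p.8] -/
theorem rfQ_apply (A : Discrete PUnit.{1}) (b : (qpPerfDatum p).B.obj (op A)) :
    rfQ p A b = (qpPerfDatum p).resK A b := rfl

/-- `rfQ'` is `resK`. [cite: MochizukiFrdII2008, Ex 1.1 (ii) p.8] -/
theorem rfQ'_apply (A : Discrete PUnit.{1}) (b : (qpPrimDatum p).B.obj (op A)) :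
    rfQ' p A b = (qpPrimDatum p).resK A b := rfl

/-- Over the one-object base the pull-back maps of `B` fix rational functions.
[cite: MochizukiFrdII2008, Ex 1.1 (ii) p.8] -/
theorem rfQ_mapB {A A' : Discrete PUnit.{1}} (f : A ⟶ A') (u : (qpPerfDatum p).B.obj (op A')) :
    rfQ p A (((qpPerfDatum p).B.map f.op).hom u) = rfQ p A' u := by
  change (qpPerfDatum p).resK A _ = (qpPerfDatum p).resK A' u
  rw [Datum.resK_mapB]
  exact Units.ext rfl

/-- `β_A` on rational functions, read in `ℚ_pˣ`: `β_A(b)|_{K^×} = b|_{K^×} · (-1)^{n(b)}`.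
[cite: MochizukiFrdII2008, Rmk 1.2.2 p.10] -/
theorem rfQ_twistβHom (A : Discrete PUnit.{1}) (b : (qpPerfDatum p).B.obj (op A)) :
    rfQ p A (twistβHom p A b) = rfQ p A b * (-1) ^ (Multiplicative.toAdd (twistExp p A b)) :=
  resK_twistβHom p A b

/-- Rational functions of composites in `C_v = C(ℚ_p)`: `u_{ψ ∘ φ}|_{K^×} = u_ψ|_{K^×} · (u_φ|_{K^×})^{deg_Fr ψ}`
([FrdI] Thm. 5.2 (i) over the one-object base). [cite: MochizukiFrdI2008, Thm. 5.2(i) p.100] -/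
theorem rfQ_unit_comp {X Y Z : (qpPerfDatum p).frobenioid} (φ : X ⟶ Y) (ψ : Y ⟶ Z) :
    rfQ p X.base (ModelFrobenioid.unit (φ ≫ ψ)) =
      rfQ p Y.base (ModelFrobenioid.unit ψ) * rfQ p X.base (ModelFrobenioid.unit φ) ^ (ModelFrobenioid.degFr ψ : ℕ) := by
  rw [ModelFrobenioid.unit_comp, map_mul, map_pow, rfQ_mapB]

/-- **Conjugation by an isomorphism does not change the rational function** of a morphism of Frobenius degree
one in `C(ℚ_p)` (`K^×` is commutative and the base is a point). [cite: MochizukiFrdI2008, Thm. 5.2(i) p.100] -/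
theorem rfQ_unit_conj {X Y : (qpPerfDatum p).frobenioid} (α : X ≅ Y) (ψ : X ⟶ X)
    (hψ : ModelFrobenioid.degFr ψ = 1) :
    rfQ p Y.base (ModelFrobenioid.unit (α.inv ≫ ψ ≫ α.hom)) = rfQ p X.base (ModelFrobenioid.unit ψ) := by
  have hdeg := ModelFrobenioid.degFr_hom_eq_one α
  have hinv : rfQ p X.base (ModelFrobenioid.unit α.hom) * rfQ p Y.base (ModelFrobenioid.unit α.inv) = 1 := by
    have h := rfQ_unit_comp p α.inv α.hom
    rw [α.inv_hom_id, ModelFrobenioid.unit_id, map_one, hdeg.1, PNat.one_coe, pow_one] at h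
    exact h.symm
  rw [rfQ_unit_comp, rfQ_unit_comp, ModelFrobenioid.degFr_comp, hdeg.1, hψ, one_mul, PNat.one_coe, pow_one,
    pow_one, mul_comm (rfQ p X.base (ModelFrobenioid.unit α.hom)), mul_assoc, hinv, mul_one]

/-- `C⊢_v ⊆ C_v` of `ofKitQp p` does not change rational functions (the inclusion of data `B⊢ ↪ B` is the
identity on `K^×`-components). [cite: MochizukiFrdII2008, Ex 1.1 (ii) p.8] -/
theorem rfQ_unit_cdashToC_map {X X' : (qpPrimDatum p).frobenioid} (s : X ⟶ X') :
    rfQ p _ (ModelFrobenioid.unit ((ofKitQp p).CdashToC.map s)) = rfQ' p X.base (ModelFrobenioid.unit s) := by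
  rfl

/-- `C⊢_v ⊆ C_v` preserves Frobenius degrees. [cite: MochizukiFrdII2008, Ex 1.1 (ii) p.8] -/
theorem degFr_cdashToC_map {X X' : (qpPrimDatum p).frobenioid} (s : X ⟶ X') :
    ModelFrobenioid.degFr ((ofKitQp p).CdashToC.map s) = ModelFrobenioid.degFr s := rfl

/-- `p ∈ ℚ_pˣ` — the rational function of the generator of `τ_p` ("the image of `p ∈ ℚ_p^×`"), read in `ℚ_pˣ`.
[cite: MochizukiFrdII2008, Thm 1.2 (v) p.9] -/
def pU : ℚ_[p]ˣ := (qpPerfDatum p).primeUnit ⟨PUnit.unit⟩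

/-- The underlying element of `pU` is `p`. [cite: MochizukiFrdII2008, Thm 1.2 (v) p.9] -/
theorem coe_pU : (pU p : ℚ_[p]) = (p : ℕ) := rfl

/-- `v_p(p) = 1` ([FrdII] Ex. 1.1 (i): `ord(p)` generates `ord(ℤ_p^⊳)`). [cite: MochizukiFrdII2008, Ex 1.1 (i) p.7] -/
theorem unitsVal_pU : unitsVal p (pU p) = Multiplicative.ofAdd 1 := unitsVal_primeUnit p ⟨PUnit.unit⟩

/-- An object of `C⊢_v = C⊢(ℚ_p)` over the point. [cite: MochizukiFrdII2008, Ex 1.1 (ii) p.8] -/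
def ptObj : (ofKitQp p).Cdash := (⟨⟨PUnit.unit⟩, 1⟩ : (qpPrimDatum p).frobenioid)

/-- **The generator `t = (1, id, log p, p)` of `τ⊢_v(ptObj)`**: the base-identity linear endomorphism with zero
divisor `log(p)` and rational function `p` ("the image of `p ∈ ℚ_p^×` … determines a characteristic splitting",
[FrdII] Thm. 1.2 (v)). [cite: MochizukiFrdII2008, Thm 1.2 (v) p.9] -/
def genEnd : ptObj p ⟶ ptObj p :=
  ModelFrobenioid.unitEnd (Φ := (qpPrimDatum p).Φ) (B := (qpPrimDatum p).B) (DivB := (qpPrimDatum p).divB) (ptObj p)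
    ⟨_, (primSubDatum (qpBase p)
      (fun _ => isPadicLocal_qpFld p : ∀ A : Discrete PUnit.{1}, ((qpBase p).obj A).IsPadicLocal)).g_mem ⟨PUnit.unit⟩⟩
    ((primSubDatum (qpBase p)
      (fun _ => isPadicLocal_qpFld p : ∀ A : Discrete PUnit.{1}, ((qpBase p).obj A).IsPadicLocal)).lift (op ⟨PUnit.unit⟩))
    rfl

/-- The rational function of `t` is `p`. [cite: MochizukiFrdII2008, Thm 1.2 (v) p.9] -/
theorem rfQ'_unit_genEnd :
    rfQ' p _ (ModelFrobenioid.unit (Φ := (qpPrimDatum p).Φ) (B := (qpPrimDatum p).B) (DivB := (qpPrimDatum p).divB)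
      (genEnd p)) = pU p := rfl

/-- `t` has Frobenius degree one. [cite: MochizukiFrdII2008, Thm 1.2 (v) p.9] -/
theorem degFr_genEnd :
    ModelFrobenioid.degFr (Φ := (qpPrimDatum p).Φ) (B := (qpPrimDatum p).B) (DivB := (qpPrimDatum p).divB)
      (genEnd p) = 1 := rfl

/-- `t ∈ τ⊢_v(ptObj)` (the splitting of `ofKitQp p` determined by `p`). [cite: MochizukiFrdII2008, Thm 1.2 (v) p.9] -/
theorem genEnd_mem_tauDash : genEnd p ∈ (ofKitQp p).tauDash.sect (ptObj p) :=
  ⟨(qpPrimDatum p).unitEnd_mem_endSubmonoid _ _ _ _, 1, by rw [pow_one]; rfl⟩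

/-- The twisting exponent of (the image in `C_v` of) `t` is `v_p(p) = 1`. [cite: MochizukiFrdII2008, Rmk 1.2.2 p.10] -/
theorem twistExp_unit_genEnd :
    twistExp p _ (ModelFrobenioid.unit ((ofKitQp p).CdashToC.map (genEnd p))) = Multiplicative.ofAdd 1 :=
  unitsVal_primeUnit p ⟨PUnit.unit⟩

/-- The rational function of (the image in `C_v` of) `t` is `p`. [cite: MochizukiFrdII2008, Thm 1.2 (v) p.9] -/
theorem rfQ_unit_genEnd : rfQ p _ (ModelFrobenioid.unit ((ofKitQp p).CdashToC.map (genEnd p))) = pU p := rfl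

end Transport

/-! ### The refutation -/

section Main

/-- **[IUTchI] Example 3.3 (iii) (e) FAILS at the real instance `ofKitQp p`.** The typed clause `SplitFromF` asks
that EVERY self-equivalence `e` of `F̲_v = C_v` lift, along `C⊢_v ⊆ C_v`, to a self-equivalence `e'` of `C⊢_v`
PRESERVING `τ⊢_v` (and on to `C^Θ_v`). For `e := Ψ_U`, the [FrdII] Rmk. 1.2.2 unit twist of the REAL `C(ℚ_p)`
(`p ↦ -p`), any lift `e'` with `(C⊢ ⊆ C) ⋙ Ψ_U ≅ e' ⋙ (C⊢ ⊆ C)` must send the generator `t = (1, id, log p, p)` of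
`τ⊢(X)` to an endomorphism whose rational function is `-p` (conjugation by the comparison isomorphism does not
change rational functions over the one-object base), whereas every element of `τ⊢(e' X) = τ_p(e' X)` has rational
function a power `p^m` — and `p^m = -p` is impossible in `ℚ_p` (`m = 1` by valuations, then `2p = 0`). Hence the
anabelian input of print's (e) — the reconstruction of the ELEMENT `p_v` through the Kummer map of [AbsTopIII]
Prop. 3.2 (iii) for `X_F` of strictly Belyi type — is load-bearing: without it (degenerate base) the clause is
false for the real [FrdII] objects. [claim: Mochizuki2012, status: disputed] -/
theorem not_splitFromF_ofKitQp : ¬ (ofKitQp p).SplitFromF := by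
  intro h
  obtain ⟨e', e'', ⟨I⟩, hτ, -, -⟩ := h (twistEquiv p)
  clear e''
  -- the image of the generator `t` under `e'` lies in `τ⊢(e' X)`: rational function `p^m'`
  have ht' : e'.functor.map (genEnd p) ∈ (ofKitQp p).tauDash.sect (e'.functor.obj (ptObj p)) :=
    (hτ (ptObj p)).le (Submonoid.mem_map.mpr ⟨genEnd p, genEnd_mem_tauDash p, rfl⟩)
  obtain ⟨-, m', hm'⟩ := ht'
  have hl : rfQ p _ (ModelFrobenioid.unit ((e'.functor ⋙ (ofKitQp p).CdashToC).map (genEnd p))) = pU p ^ m' := by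
    change rfQ' p _ (ModelFrobenioid.unit (Φ := (qpPrimDatum p).Φ) (B := (qpPrimDatum p).B)
      (DivB := (qpPrimDatum p).divB) (e'.functor.map (genEnd p))) = _
    exact hm'
  -- the comparison isomorphism conjugates `(C⊢ ⊆ C)(e' t)` into `Ψ_U((C⊢ ⊆ C) t)`: rational function `-p`
  have hconj : (e'.functor ⋙ (ofKitQp p).CdashToC).map (genEnd p) =
      I.inv.app (ptObj p) ≫ ((ofKitQp p).CdashToC ⋙ (twistEquiv p).functor).map (genEnd p) ≫ I.hom.app (ptObj p) := by
    rw [I.hom.naturality, ← Category.assoc, Iso.inv_hom_id_app, Category.id_comp]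
  have hdeg : ModelFrobenioid.degFr (((ofKitQp p).CdashToC ⋙ (twistEquiv p).functor).map (genEnd p)) = 1 := rfl
  have hr : rfQ p _ (ModelFrobenioid.unit ((e'.functor ⋙ (ofKitQp p).CdashToC).map (genEnd p))) = -(pU p) := by
    rw [hconj]
    refine (rfQ_unit_conj p (I.app (ptObj p)) _ hdeg).trans ?_
    change rfQ p _ (twistβHom p _ (ModelFrobenioid.unit ((ofKitQp p).CdashToC.map (genEnd p)))) = _
    rw [rfQ_twistβHom, twistExp_unit_genEnd, rfQ_unit_genEnd, toAdd_ofAdd, zpow_one, mul_neg_one]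
  -- `p^m' = -p` in `ℚ_pˣ`
  have key : pU p ^ m' = -(pU p) := hl.symm.trans hr
  -- valuations: `m' = 1`
  have hv := congrArg (fun x : ℚ_[p]ˣ => Multiplicative.toAdd (unitsVal p x)) key
  simp only [map_pow, unitsVal_pU, ← neg_one_mul (pU p), map_mul, unitsVal_neg_one, one_mul, ← ofAdd_nsmul,
    toAdd_ofAdd, nsmul_eq_mul, mul_one] at hv
  have hm1 : m' = 1 := by exact_mod_cast hv
  rw [hm1, pow_one] at key
  -- `p = -p` in `ℚ_p`: absurd
  have hval : (pU p : ℚ_[p]) = -(pU p : ℚ_[p]) := by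
    rw [← Units.val_neg]
    exact congrArg Units.val key
  exact (pU p).ne_zero (add_self_eq_zero.mp (eq_neg_iff_add_eq_zero.mp hval))

/-- **Ex. 3.3 (iii) as typed is not satisfiable in full at `ofKitQp p`**: the conjunction of the five clauses
(a)–(e) fails there ((a)(b)(c) hold — `GoodLocalFrobenioidOfKitQpReconstruction.lean` —, (e) fails). Contrast:
all five hold on the trivial inhabitant (`GoodLocalFrobenioidClaimsWitness.lean`), so (e) is INDEPENDENT of the
interface and, at the real [FrdII] objects, genuinely needs print's anabelian input. [claim: Mochizuki2012, status: disputed] -/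
theorem not_ex33iii_all_ofKitQp :
    ¬ ((ofKitQp p).DdashFromD ∧ (ofKitQp p).BasesFromC ∧ (ofKitQp p).DFromF ∧ (ofKitQp p).CdashFromF ∧
      (ofKitQp p).SplitFromF) :=
  fun h => not_splitFromF_ofKitQp p h.2.2.2.2

/-- Hence the universally quantified form of (e) is refuted by a REAL instance (not only by an artificial
inhabitant of the interface). [claim: Mochizuki2012, status: disputed] -/
theorem not_forall_splitFromF :
    ¬ ∀ (q : ℕ) (Kv : Type) [Field Kv] [ValuativeRel Kv] (G : GoodLocalFrobenioid.{0} q Kv), G.SplitFromF :=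
  fun h => not_splitFromF_ofKitQp 2 (h 2 ℚ_[2] (ofKitQp 2))

end Main

end GoodLocalFrobenioid

end Literature.IUT.HodgeTheaters
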